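import Literature.Topology.FourManifolds.CofacePair
import Mathlib.LinearAlgebra.Projection
import Mathlib.Topology.Algebra.Module.FiniteDimension
import HarnessLib

/-!
# The affine frame of a facet: `Q ≅ W × ℝ` with the height as last coordinate

Topic `Literature/Topology/FourManifolds`; bookkeeping for stage 1 (codimension one) of the
smoothing sweep (Munkres, Ann. of Math. 72 (1960), §2).  For an affine basis `b` of `Q`, an index
`i₀` (the apex) and a base vertex `j₀ ≠ i₀` of the opposite facet, let `W = facetDir b i₀` be the
direction of the facet and `ν = b i₀ - b j₀`.  Then `Q = W ⊕ ℝ ν`, and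

* `facetFrame b hj : (W × ℝ) ≃L[ℝ] Q`, `(w, σ) ↦ w + σ • ν` (`facetFrame_apply`);
* `coord_facetFrame` — the height of `b j₀ + facetFrame (w, σ)` is `σ`
  (`b.coord i₀ (b j₀ + facetFrame b hj (w, σ)) = σ`): the hypothesis `hA` (with `c = 1`) of
  `CreaseNormalFormConstruction.exists_creaseNormalForm`;
* `facetCore b i₀ j₀ m` — the parameters `w : W` whose base point `b j₀ + w` has all facet
  coordinates `≥ m` (compact for `m ≥ 0`), and the open strict version `facetCoreOpen`.

Everything is proved; the definitions are explicit; no named facts.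

## References

* J. R. Munkres, *Obstructions to the smoothing of piecewise-differentiable homeomorphisms*, Ann.
  of Math. (2) 72 (1960), 521–554, §2. [Munkres1960]
-/

noncomputable section

open Set Function Metric Filter Submodule
open scoped Topology

namespace Literature.Topology.FourManifolds

variable {Q : Type*} [NormedAddCommGroup Q] [NormedSpace ℝ Q] [FiniteDimensional ℝ Q]
  [DecidableEq Q]
variable {ι : Type*} [Fintype ι] [DecidableEq ι]

/-- The direction of the facet opposite `i₀`. [folklore] -/
def facetDir (b : AffineBasis ι ℝ Q) (i₀ : ι) : Submodule ℝ Q :=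
  vectorSpan ℝ (facet b i₀ : Set Q)

omit [FiniteDimensional ℝ Q] in
/-- Differences of facet vertices lie in the facet direction. [folklore] -/
theorem vsub_mem_facetDir (b : AffineBasis ι ℝ Q) {i₀ i j : ι} (hi : i ≠ i₀) (hj : j ≠ i₀) :
    b i - b j ∈ facetDir b i₀ :=
  vsub_mem_vectorSpan ℝ (Finset.mem_coe.2 (mem_facet_iff.2 ⟨i, hi, rfl⟩))
    (Finset.mem_coe.2 (mem_facet_iff.2 ⟨j, hj, rfl⟩))

omit [FiniteDimensional ℝ Q] in
/-- The linear part of the height vanishes on the facet direction. [folklore] -/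
theorem coord_linear_eq_zero_of_mem_facetDir (b : AffineBasis ι ℝ Q) (i₀ : ι) {w : Q}
    (hw : w ∈ facetDir b i₀) : (b.coord i₀).linear w = 0 := by
  unfold facetDir vectorSpan at hw
  induction hw using Submodule.span_induction with
  | mem x hx =>
    obtain ⟨p, hp, q, hq, rfl⟩ := hx
    have := (b.coord i₀).linearMap_vsub p q
    rw [this, coord_eq_zero_of_mem_facet (Finset.mem_coe.1 hp),
      coord_eq_zero_of_mem_facet (Finset.mem_coe.1 hq)]
    simp
  | zero => simp
  | add x y _ _ hx hy => rw [map_add, hx, hy, add_zero]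
  | smul a x _ hx => rw [map_smul, hx, smul_zero]

omit [FiniteDimensional ℝ Q] [DecidableEq Q] [Fintype ι] [DecidableEq ι] in
/-- The linear part of the height is `1` on the apex vector `b i₀ - b j₀`. [folklore] -/
theorem coord_linear_apex (b : AffineBasis ι ℝ Q) {i₀ j₀ : ι} (hj : j₀ ≠ i₀) :
    (b.coord i₀).linear (b i₀ - b j₀) = 1 := by
  have := (b.coord i₀).linearMap_vsub (b i₀) (b j₀)
  simp only [vsub_eq_sub] at this
  rw [this, b.coord_apply_eq, b.coord_apply_ne hj.symm]
  simp

omit [FiniteDimensional ℝ Q] in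
/-- The apex vector is not in the facet direction. [folklore] -/
theorem apex_notMem_facetDir (b : AffineBasis ι ℝ Q) {i₀ j₀ : ι} (hj : j₀ ≠ i₀) :
    b i₀ - b j₀ ∉ facetDir b i₀ := fun h => by
  have := coord_linear_eq_zero_of_mem_facetDir b i₀ h
  rw [coord_linear_apex b hj] at this
  exact one_ne_zero this

omit [FiniteDimensional ℝ Q] in
/-- The apex vector is nonzero. [folklore] -/
theorem apex_ne_zero (b : AffineBasis ι ℝ Q) {i₀ j₀ : ι} (hj : j₀ ≠ i₀) : b i₀ - b j₀ ≠ 0 :=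
  fun h => apex_notMem_facetDir b hj (by rw [h]; exact zero_mem _)

omit [FiniteDimensional ℝ Q] in
/-- **The facet direction and the apex line are complementary.** [folklore] -/
theorem isCompl_facetDir_span_apex (b : AffineBasis ι ℝ Q) {i₀ j₀ : ι} (hj : j₀ ≠ i₀) :
    IsCompl (facetDir b i₀) (ℝ ∙ (b i₀ - b j₀)) := by
  constructor
  · rw [disjoint_def]
    intro x hx hx'
    obtain ⟨t, rfl⟩ := mem_span_singleton.1 hx'
    by_contra hne
    have ht : t ≠ 0 := fun h => hne (by rw [h, zero_smul])
    have : b i₀ - b j₀ ∈ facetDir b i₀ := by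
      have := (facetDir b i₀).smul_mem t⁻¹ hx
      rwa [smul_smul, inv_mul_cancel₀ ht, one_smul] at this
    exact apex_notMem_facetDir b hj this
  · rw [codisjoint_iff, eq_top_iff]
    have htot : vectorSpan ℝ (range b) = ⊤ := by
      rw [← AffineSubspace.direction_top ℝ Q Q, ← b.tot, direction_affineSpan]
    rw [← htot, vectorSpan_range_eq_span_range_vsub_right ℝ b j₀, span_le]
    rintro _ ⟨i, rfl⟩
    simp only [vsub_eq_sub, SetLike.mem_coe]
    by_cases hi : i = i₀
    · subst hi; exact mem_sup_right (mem_span_singleton_self _)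
    · exact mem_sup_left (vsub_mem_facetDir b hi hj)

/-- **The facet frame** `(w, σ) ↦ w + σ • (b i₀ - b j₀)`, a continuous linear isomorphism
`W × ℝ ≃ Q`. [folklore] -/
def facetFrame (b : AffineBasis ι ℝ Q) {i₀ j₀ : ι} (hj : j₀ ≠ i₀) :
    (facetDir b i₀ × ℝ) ≃L[ℝ] Q :=
  (((LinearEquiv.refl ℝ (facetDir b i₀)).prodCongr
      (LinearEquiv.toSpanNonzeroSingleton ℝ Q (b i₀ - b j₀) (apex_ne_zero b hj))).trans
    (prodEquivOfIsCompl _ _ (isCompl_facetDir_span_apex b hj))).toContinuousLinearEquiv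

/-- The formula of the facet frame. [folklore] -/
@[simp]
theorem facetFrame_apply (b : AffineBasis ι ℝ Q) {i₀ j₀ : ι} (hj : j₀ ≠ i₀)
    (p : facetDir b i₀ × ℝ) : facetFrame b hj p = (p.1 : Q) + p.2 • (b i₀ - b j₀) := by
  simp [facetFrame]

/-- **The height in the facet frame is the last coordinate**:
`b.coord i₀ (b j₀ + facetFrame (w, σ)) = σ`. [folklore] -/
theorem coord_facetFrame (b : AffineBasis ι ℝ Q) {i₀ j₀ : ι} (hj : j₀ ≠ i₀)
    (p : facetDir b i₀ × ℝ) : b.coord i₀ (b j₀ + facetFrame b hj p) = p.2 := by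
  rw [facetFrame_apply]
  have h := (b.coord i₀).map_vadd (b j₀) ((p.1 : Q) + p.2 • (b i₀ - b j₀))
  simp only [vadd_eq_add] at h
  rw [add_comm] at h
  rw [h, map_add, map_smul, coord_linear_eq_zero_of_mem_facetDir b i₀ p.1.2,
    coord_linear_apex b hj, b.coord_apply_ne hj.symm]
  simp

/-! ### The compact and open cores of the facet in the frame -/

/-- **The closed core** of margin `m`: parameters whose base point has all facet coordinates
`≥ m`. [folklore] -/
def facetCore (b : AffineBasis ι ℝ Q) (i₀ j₀ : ι) (m : ℝ) : Set (facetDir b i₀) :=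
  {w | ∀ i, i ≠ i₀ → m ≤ b.coord i (b j₀ + (w : Q))}

/-- **The open core** of margin `m`: strict inequalities. [folklore] -/
def facetCoreOpen (b : AffineBasis ι ℝ Q) (i₀ j₀ : ι) (m : ℝ) : Set (facetDir b i₀) :=
  {w | ∀ i, i ≠ i₀ → m < b.coord i (b j₀ + (w : Q))}

/-- The open core is open. [folklore] -/
theorem isOpen_facetCoreOpen (b : AffineBasis ι ℝ Q) (i₀ j₀ : ι) (m : ℝ) :
    IsOpen (facetCoreOpen b i₀ j₀ m) := by
  have : facetCoreOpen b i₀ j₀ m = ⋂ i ∈ ({i | i ≠ i₀} : Set ι),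
      {w : facetDir b i₀ | m < b.coord i (b j₀ + (w : Q))} := by
    ext w; simp [facetCoreOpen]
  rw [this]
  refine (Set.toFinite _).isOpen_biInter fun i _ => ?_
  exact isOpen_lt continuous_const
    ((b.coord i).continuous_of_finiteDimensional.comp (continuous_const.add continuous_subtype_val))

/-- The closed core is closed. [folklore] -/
theorem isClosed_facetCore (b : AffineBasis ι ℝ Q) (i₀ j₀ : ι) (m : ℝ) :
    IsClosed (facetCore b i₀ j₀ m) := by
  have : facetCore b i₀ j₀ m = ⋂ i ∈ ({i | i ≠ i₀} : Set ι),
      {w : facetDir b i₀ | m ≤ b.coord i (b j₀ + (w : Q))} := by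
    ext w; simp [facetCore]
  rw [this]
  refine isClosed_biInter fun i _ => ?_
  exact isClosed_le continuous_const
    ((b.coord i).continuous_of_finiteDimensional.comp (continuous_const.add continuous_subtype_val))

omit [FiniteDimensional ℝ Q] in
/-- The open core of margin `m` lies in the closed core of any margin `m' ≤ m`. [folklore] -/
theorem facetCoreOpen_subset_facetCore (b : AffineBasis ι ℝ Q) (i₀ j₀ : ι) {m m' : ℝ}
    (h : m' ≤ m) : facetCoreOpen b i₀ j₀ m ⊆ facetCore b i₀ j₀ m' :=
  fun _ hw i hi => h.trans (hw i hi).le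

/-- Base points of the closed core with nonnegative margin have height `0` and lie in the closed
facet. [folklore] -/
theorem mem_convexHull_facet_of_mem_facetCore (b : AffineBasis ι ℝ Q) {i₀ j₀ : ι} (hj : j₀ ≠ i₀)
    {m : ℝ} (hm : 0 ≤ m) {w : facetDir b i₀} (hw : w ∈ facetCore b i₀ j₀ m) :
    b.coord i₀ (b j₀ + (w : Q)) = 0 ∧
      b j₀ + (w : Q) ∈ convexHull ℝ (facet b i₀ : Set Q) := by
  have h0 : b.coord i₀ (b j₀ + (w : Q)) = 0 := by
    have := coord_facetFrame b hj (w, 0)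
    simpa using this
  refine ⟨h0, ?_⟩
  have hsum : ∑ i, b.coord i (b j₀ + (w : Q)) = 1 := b.sum_coord_apply_eq_one _
  have hrepr : ∑ i, b.coord i (b j₀ + (w : Q)) • b i = b j₀ + (w : Q) :=
    b.linear_combination_coord_eq_self _
  have hsum' : ∑ i ∈ Finset.univ.erase i₀, b.coord i (b j₀ + (w : Q)) = 1 := by
    rw [← Finset.add_sum_erase _ _ (Finset.mem_univ i₀), h0, zero_add] at hsum; exact hsum
  have hrepr' : ∑ i ∈ Finset.univ.erase i₀, b.coord i (b j₀ + (w : Q)) • b i = b j₀ + (w : Q) := by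
    rw [← Finset.add_sum_erase _ _ (Finset.mem_univ i₀), h0, zero_smul, zero_add] at hrepr
    exact hrepr
  rw [← hrepr']
  refine (convex_convexHull ℝ _).sum_mem (fun i hi => ?_) hsum' fun i hi => ?_
  · exact hm.trans (hw i (Finset.ne_of_mem_erase hi))
  · exact subset_convexHull ℝ _
      (Finset.mem_coe.2 (mem_facet_iff.2 ⟨i, Finset.ne_of_mem_erase hi, rfl⟩))

/-- **The closed core is compact** (for `m ≥ 0`): it is closed, and bounded because its base
points lie in the compact closed facet. [folklore] -/
theorem isCompact_facetCore (b : AffineBasis ι ℝ Q) {i₀ j₀ : ι} (hj : j₀ ≠ i₀) {m : ℝ}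
    (hm : 0 ≤ m) : IsCompact (facetCore b i₀ j₀ m) := by
  have hK : IsCompact (convexHull ℝ (facet b i₀ : Set Q)) :=
    (facet b i₀).finite_toSet.isCompact_convexHull ℝ
  obtain ⟨R, hR⟩ := hK.isBounded.subset_closedBall (b j₀)
  refine Metric.isCompact_of_isClosed_isBounded (isClosed_facetCore b i₀ j₀ m) ?_
  refine (Metric.isBounded_closedBall (x := (0 : facetDir b i₀)) (r := R)).subset fun w hw => ?_
  have hmem := (mem_convexHull_facet_of_mem_facetCore b hj hm hw).2
  have := hR hmem
  rw [mem_closedBall, dist_eq_norm, add_sub_cancel_left] at this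
  rw [mem_closedBall, dist_zero_right]
  exact this

end Literature.Topology.FourManifolds
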